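import Summits.QuantumFields.YangMills.Theorems.BalabanUVNodesN18KernelStepRateKingMechanism
import Summits.QuantumFields.YangMills.Theorems.BalabanUVNodesN18AtRecordOfKernelLetters
import Summits.QuantumFields.YangMills.Theorems.BalabanUVNodesN22WindowSoftTwoPointAtSlots

/-!
# BalabanUVNodes ∕ N18 — KING's MECHANISM AT THE KERNEL OBJECTS, FILE 3: AT FINITE VOLUME (where King's tori live) — the three-factor mechanism on the WINDOWED kernels
# `Π^{(K)}_{k+1,μν}` of [Balaban1987RG1] (1.20), uniformly in `K`, ⟹ node00-def-W1 W1-19b's `WindowedStepRate` (hence the N18 letter `KernelStepRate` given (1.21)'s existence) and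
# `WindowedDecay` from the SIZES; record editions `WindowedStepRateOfRecord₁₃` ∕ `WindowedDecayOfRecord₁₃` = the N18 row `hS` and the (D4) row `hW` of dag-n27-w1's v5 bill
# `K3V5Defs.keyedRatesHolderD4_rrOfRecord_of_pins_of_letters` (p606160) (Track A, DAG node N18 = NE5; key K3⁷ `SpineGivenEndpointR13SepCoPH` stmt-QuantumFields-20544, skeleton v5
# 941dddb108cbaacf; width seat `pub-ymgap-dag-n18-w4` g0; FILE 3 after `…N18KernelStepRateKingMechanism` p606901)

HONEST FRAMING.  Count-neutral kernel bookkeeping BY NAME (`--kind proof --supports stmt-QuantumFields-20544 --as helper`).  HYPOTHESIS-FORM: the three-factor structure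
`u ⬝ (E v)` of the WINDOWED finite-volume kernels, their sizes, one-line rates `c·θ₅^{k+1}` and lattice sums — UNIFORM IN THE VOLUME INDEX `K` — are HYPOTHESES (C. King's printed
model of the mechanism, [King1986] p. 665 «the error is the same graph with a difference of propagators on one line … Proposition 3.8 gives the desired factor L^{−γk}»,
(4.42)–(4.43) p. 675); [Balaban1987RG1] Thm 1 p. 259 prints the UNIFORMITY in the spacing only — the windowed two-run RATE is NOT PRINTED for d = 4 and NOT proved here; (5.10)
for the windowed kernels is NOT discharged.  Nothing of Bałaban is asserted; N18 ∕ (D4) NOT discharged; K3⁷ OPEN, not claimed; counts UNMOVED (typed 28∕28 · discharged 5∕27,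
A 5∕28).  Finite 𝕋⁴ at fixed `ε`; R4 closes the conditional rung `BalabanLadder.UV` only — NOT ℝ⁴ ∕ infinite volume ∕ OS ∕ mass gap ∕ Clay.  THEOREMS ONLY: 0 `def`, 0 `sorry`.

WHAT.
* §5 (generic term family `ℰ`, probe `ρ`, basis `bV`; summation lattices `βK K k` indexed by volume AND level): ★★ `windowedStepRate_of_threeFactorRates` — for every box history
  `w ∈ ]0, γ]^{k+2}` and entry `(μ, ν, x)`, EVENTUALLY IN `K` run A's `polWindow F K (k+1) (ℰ k (tail w) K) … x = u_A ⬝ (E_A v_A)` and run B's `polWindow F (K+s) (k+2) (ℰ (k+1) w (K+s)) … x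
  = u_B ⬝ (E_B v_B)`, with sizes `sA, sC, sB`, one-line rates `cA·θ₅^{k+1}, cC·θ₅^{k+1}, cB·θ₅^{k+1}`, decay `κ` through positions at pseudo-distance `≥ |x|₁`, lattice sums `≤ V`, ALL
  UNIFORM IN `K` ⟹ `WindowedStepRate F ℰ ρ bV γ s (κ∕2) θ₅ (((cA·sC·sB + sA·cC·sB + sA·sC·cB)·V²)·θ₅)` (the `C₅·θ₅` form); ★ `kernelStepRate_of_threeFactorRates_finiteVolume` — plus
  W1-19b's `PolLimitsExistBox` ⟹ `KernelStepRate … (κ∕2) θ₅ ((…)·V²)` by dag-n18-w1's `kernelStepRate_of_windowed` (road (A) of N18-KERNEL-INDEX, its `WindowedStepRate` input supplied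
  by King's mechanism); ★ `windowedDecay_of_threeFactorSizes` — run A's SIZES at the box histories `v ∈ ]0, γ]^{k+1}` ⟹ `WindowedDecay F ℰ ρ bV (Window γ) μ ν (κ∕2)` (uniform constant
  `sA·sC·sB·V²`); `windowedStepRate_mono` (the rate-antitonicity of `WindowedDecay` is dag-n22-w2's `windowedDecay_of_le`, p-landed, cited not restated).
* §6 AT THE RECORD (Stage 13, the merged term family of record `mergedTermFamilyMatT F N (TβOfRecord₁₃ F N) (chiβOfRecord₁₃ F N θ) θ.εbg` in the record's β-chart, instances bound by
  `letI` as in W1-19b): `windowedStepRateOfRecord₁₃_of_threeFactorRates` ∕ `kernelStepRateOfRecord₁₃_of_threeFactorRates_finiteVolume` (+ `PolLimitsExistBoxOfRecord₁₃`, e.g. from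
  `GeometricIncrementsOfRecord₁₃` by dag-n18-w2's p606911) ∕ `windowedDecayOfRecord₁₃_of_threeFactorSizes` ∕ `…_mono` ∕ `…_anti` — at a letter block `ℓ F θ`
  DOMINATING the mechanism's letters these are EXACTLY the rows `hS : WindowedStepRateOfRecord₁₃ F 2 θ' (s F θ) (ℓ F θ).κ (ℓ F θ).θ₅ ((ℓ F θ).C₅ * (ℓ F θ).θ₅)` and `hW :
  WindowedDecayOfRecord₁₃ F 2 θ' 0 1 (ℓ F θ).κ` of `K3V5Defs.keyedRatesHolderD4_rrOfRecord_of_pins_of_letters` — King's mechanism AS THE SUPPLIER of the v5 bill's N18 and (D4) rows.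

Sources (TYPES and the mechanism only): C. King, Commun. Math. Phys. **102** (1986) 649–677 [King1986] — Prop. 3.9 (3.73) p. 665, (4.41)–(4.43) p. 675; T. Bałaban, Commun.
Math. Phys. **109** (1987) 249–301 [Balaban1987RG1] — Thm 1 p. 259, (1.6) p. 261, (1.20)–(1.21) p. 264, (5.10) p. 293.  No claim about the mass gap.
-/

noncomputable section

namespace YMDAG.N18.KernelStepRateKingMechanism

open scoped BigOperators
open Matrix Filter
open Literature.MathematicalPhysics.QuantumFieldTheory.Balaban1983to89
open Literature.MathematicalPhysics.QuantumFieldTheory.Balaban1983to89.T4Continuum (T4Family)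
open Literature.MathematicalPhysics.QuantumFieldTheory.Balaban1983to89.T4OutputRate (Window)
open Literature.MathematicalPhysics.QuantumFieldTheory.Balaban1983to89.B12Sec2to5 (l1 l1_nonneg)
open Literature.MathematicalPhysics.QuantumFieldTheory.Balaban1983to89.FlowStep (Box mem_box)
open Node00 (Stage13Params TermFamily1 polWindow mergedTermFamilyMatT TβOfRecord₁₃ chiβOfRecord₁₃)
open Node00.U3OfKernels (histPrefix)
open Node00.U3KernelLetters (KernelStepRate WindowedStepRate WindowedDecay PolLimitsExistBox KernelStepRateOfRecord₁₃ PolLimitsExistBoxOfRecord₁₃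
  WindowedStepRateOfRecord₁₃ WindowedDecayOfRecord₁₃)
open Summit.QuantumFields.YangMills.BalabanUVNodes.N18KingModelScales (bilin3_rate bilin_decay_bound)
open YMDAG.N18.AtRecordOfKernelLetters (kernelStepRate_of_windowed kernelStepRateOfRecord₁₃_of_windowed)
open YMDAG.N22.WindowSoftTwoPoint (windowedDecay_of_le)

/-! ## §5 Generic term family, finite volume: the mechanism on the windowed kernels ⟹ `WindowedStepRate` ∕ `WindowedDecay` -/

section FiniteVolume

variable {𝔄 : Type*} [NormedRing 𝔄] [NormedAlgebra ℝ 𝔄]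
variable {V𝔳 : Type*} [NormedAddCommGroup V𝔳] [NormedSpace ℝ V𝔳] {ι : Type*} [Fintype ι]
variable (F : T4Family) (ℰ : TermFamily1 F 𝔄) (ρ : V𝔳 →L[ℝ] 𝔄) (bV : Module.Basis ι ℝ V𝔳)
variable {βK : ℕ → ℕ → Type*} [∀ K k, Fintype (βK K k)] {PK : ℕ → ℕ → Type*}

/-- ★★ **KING's MECHANISM AT FINITE VOLUME PRODUCES THE WINDOWED TWO-RUN STEP RATE.**  On the tori `T_K` (King's own setting): if, for every box history `w ∈ ]0, γ]^{k+2}` and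
entry `(μ, ν, x)`, EVENTUALLY IN `K` run A's windowed kernel `Π^{(K)}_{k+1,μν}(tail w; x)` and run B's `Π^{(K+s)}_{k+2,μν}(w; x)` are three-factor read-outs over a `(K, k)`-indexed
summation lattice, with sizes `sA, sC, sB`, one-line rates `cA·θ₅^{k+1}, cC·θ₅^{k+1}, cB·θ₅^{k+1}`, decay `κ` through positions at pseudo-distance `≥ |x|₁` and lattice sums `≤ V` —
ALL UNIFORM IN `K` —, then W1-19b's `WindowedStepRate F ℰ ρ bV γ s (κ∕2) θ₅ (((cA·sC·sB + sA·cC·sB + sA·sC·cB)·V²)·θ₅)` (the `C₅·θ₅` form dag-n18-w1's `kernelStepRate_of_windowed`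
consumes).  [Balaban1987RG1] Thm 1 read at finite volume is NOT PRINTED in this form; the hypotheses ARE the estimate. [cite: King1986, Prop. 3.9 (3.73) p.665 and (4.42)–(4.43) p.675; Balaban1987RG1, Thm 1 p.259 and (1.20)–(1.21) p.264] -/
theorem windowedStepRate_of_threeFactorRates (s : ℕ)
    (ρd : (K k : ℕ) → PK K k → PK K k → ℝ) (hρ0 : ∀ K k p q, 0 ≤ ρd K k p q) (hρtri : ∀ K k p q r, ρd K k p r ≤ ρd K k p q + ρd K k q r)
    (q : (K k : ℕ) → βK K k → PK K k) (p r : (K k : ℕ) → Fin 4 → Fin 4 → (Fin 4 → ℤ) → PK K k)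
    (uA vA uB vB : (K k : ℕ) → (Fin (k + 2) → ℝ) → Fin 4 → Fin 4 → (Fin 4 → ℤ) → βK K k → ℝ)
    (CA CB : (K k : ℕ) → (Fin (k + 2) → ℝ) → Fin 4 → Fin 4 → (Fin 4 → ℤ) → Matrix (βK K k) (βK K k) ℝ)
    {γ κ θ₅ sA sC sB cA cC cB V : ℝ} (hκ : 0 ≤ κ) (hθ : 0 ≤ θ₅) (hsA : 0 ≤ sA) (hsC : 0 ≤ sC) (hsB : 0 ≤ sB)
    (hcA : 0 ≤ cA) (hcC : 0 ≤ cC) (hcB : 0 ≤ cB)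
    (hE : ∀ (k : ℕ) (w : Fin (k + 2) → ℝ), w ∈ Box γ (k + 1) → ∀ (μ ν : Fin 4) (x : Fin 4 → ℤ), ∀ᶠ K in atTop,
      polWindow F K (k + 1) (ℰ k (Fin.tail w) K) ρ bV μ ν x = uA K k w μ ν x ⬝ᵥ (CA K k w μ ν x *ᵥ vA K k w μ ν x) ∧
      polWindow F (K + s) (k + 1 + 1) (ℰ (k + 1) w (K + s)) ρ bV μ ν x = uB K k w μ ν x ⬝ᵥ (CB K k w μ ν x *ᵥ vB K k w μ ν x))
    (hu : ∀ (K k : ℕ) (w : Fin (k + 2) → ℝ) (μ ν : Fin 4) (x : Fin 4 → ℤ) (i : βK K k),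
      |uA K k w μ ν x i| ≤ sA * Real.exp (-(κ * ρd K k (p K k μ ν x) (q K k i))))
    (hCA : ∀ (K k : ℕ) (w : Fin (k + 2) → ℝ) (μ ν : Fin 4) (x : Fin 4 → ℤ) (i i' : βK K k),
      |CA K k w μ ν x i i'| ≤ sC * Real.exp (-(κ * ρd K k (q K k i) (q K k i'))))
    (hCB : ∀ (K k : ℕ) (w : Fin (k + 2) → ℝ) (μ ν : Fin 4) (x : Fin 4 → ℤ) (i i' : βK K k),
      |CB K k w μ ν x i i'| ≤ sC * Real.exp (-(κ * ρd K k (q K k i) (q K k i'))))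
    (hv : ∀ (K k : ℕ) (w : Fin (k + 2) → ℝ) (μ ν : Fin 4) (x : Fin 4 → ℤ) (i' : βK K k),
      |vB K k w μ ν x i'| ≤ sB * Real.exp (-(κ * ρd K k (q K k i') (r K k μ ν x))))
    (hdu : ∀ (K k : ℕ) (w : Fin (k + 2) → ℝ) (μ ν : Fin 4) (x : Fin 4 → ℤ) (i : βK K k),
      |uB K k w μ ν x i - uA K k w μ ν x i| ≤ cA * θ₅ ^ (k + 1) * Real.exp (-(κ * ρd K k (p K k μ ν x) (q K k i))))
    (hdC : ∀ (K k : ℕ) (w : Fin (k + 2) → ℝ) (μ ν : Fin 4) (x : Fin 4 → ℤ) (i i' : βK K k),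
      |CB K k w μ ν x i i' - CA K k w μ ν x i i'| ≤ cC * θ₅ ^ (k + 1) * Real.exp (-(κ * ρd K k (q K k i) (q K k i'))))
    (hdv : ∀ (K k : ℕ) (w : Fin (k + 2) → ℝ) (μ ν : Fin 4) (x : Fin 4 → ℤ) (i' : βK K k),
      |vB K k w μ ν x i' - vA K k w μ ν x i'| ≤ cB * θ₅ ^ (k + 1) * Real.exp (-(κ * ρd K k (q K k i') (r K k μ ν x))))
    (hV : ∀ (K k : ℕ) (t : PK K k), ∑ i, Real.exp (-(κ / 2 * ρd K k t (q K k i))) ≤ V)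
    (hd : ∀ (K k : ℕ) (μ ν : Fin 4) (x : Fin 4 → ℤ), l1 x ≤ ρd K k (p K k μ ν x) (r K k μ ν x)) :
    WindowedStepRate F ℰ ρ bV γ s (κ / 2) θ₅ (((cA * sC * sB + sA * cC * sB + sA * sC * cB) * V ^ 2) * θ₅) := by
  intro k w hw μ ν x
  refine (hE k w hw μ ν x).mono fun K hK => ?_
  rw [hK.1, hK.2]
  have hθj : 0 ≤ θ₅ ^ (k + 1) := pow_nonneg hθ _
  have h := bilin3_rate (ρd K k) (hρ0 K k) (hρtri K k) (q K k) (p K k μ ν x) (r K k μ ν x) (uA K k w μ ν x) (uB K k w μ ν x)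
    (vA K k w μ ν x) (vB K k w μ ν x) (CA K k w μ ν x) (CB K k w μ ν x) hκ hsA hsC hsB
    (mul_nonneg hcA hθj) (mul_nonneg hcC hθj) (mul_nonneg hcB hθj)
    (hu K k w μ ν x) (hCA K k w μ ν x) (hCB K k w μ ν x) (hv K k w μ ν x)
    (hdu K k w μ ν x) (hdC K k w μ ν x) (hdv K k w μ ν x) (hV K k)
  refine h.trans ?_
  have hK0 : 0 ≤ (cA * sC * sB + sA * cC * sB + sA * sC * cB) * V ^ 2 * θ₅ ^ (k + 1) := by positivity
  have hexp : Real.exp (-(κ / 2 * ρd K k (p K k μ ν x) (r K k μ ν x))) ≤ Real.exp (-(κ / 2) * l1 x) := by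
    rw [neg_mul]
    exact Real.exp_le_exp.mpr (neg_le_neg (mul_le_mul_of_nonneg_left (hd K k μ ν x) (by positivity)))
  calc (cA * θ₅ ^ (k + 1) * sC * sB + sA * (cC * θ₅ ^ (k + 1)) * sB + sA * sC * (cB * θ₅ ^ (k + 1))) * V ^ 2
          * Real.exp (-(κ / 2 * ρd K k (p K k μ ν x) (r K k μ ν x)))
      = (cA * sC * sB + sA * cC * sB + sA * sC * cB) * V ^ 2 * θ₅ ^ (k + 1)
          * Real.exp (-(κ / 2 * ρd K k (p K k μ ν x) (r K k μ ν x))) := by ring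
    _ ≤ (cA * sC * sB + sA * cC * sB + sA * sC * cB) * V ^ 2 * θ₅ ^ (k + 1) * Real.exp (-(κ / 2) * l1 x) :=
        mul_le_mul_of_nonneg_left hexp hK0
    _ = (cA * sC * sB + sA * cC * sB + sA * sC * cB) * V ^ 2 * θ₅ * θ₅ ^ k * Real.exp (-(κ / 2) * l1 x) := by ring

/-- ★ **… HENCE THE N18 LETTER, GIVEN (1.21)'s EXISTENCE ON THE BOXES**: the finite-volume mechanism (uniform in `K`) and W1-19b's `PolLimitsExistBox F ℰ ρ bV γ` give
`KernelStepRate F ℰ ρ bV γ (κ∕2) θ₅ ((cA·sC·sB + sA·cC·sB + sA·sC·cB)·V²)` — the boxed rate passes to the limiting kernels by dag-n18-w1's `kernelStepRate_of_windowed`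
(`le_of_tendsto`, `…KernelStepRateBoxes` §2b).  Road (A) of dag-n18-w1's N18-KERNEL-INDEX with its `WindowedStepRate` input supplied by King's mechanism. [cite: King1986, Prop. 3.9 (3.73) p.665 and (4.42)–(4.43) p.675; Balaban1987RG1, Thm 1 p.259 and (1.20)–(1.21) p.264] -/
theorem kernelStepRate_of_threeFactorRates_finiteVolume (s : ℕ) {γ : ℝ} (hex : PolLimitsExistBox F ℰ ρ bV γ)
    (ρd : (K k : ℕ) → PK K k → PK K k → ℝ) (hρ0 : ∀ K k p q, 0 ≤ ρd K k p q) (hρtri : ∀ K k p q r, ρd K k p r ≤ ρd K k p q + ρd K k q r)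
    (q : (K k : ℕ) → βK K k → PK K k) (p r : (K k : ℕ) → Fin 4 → Fin 4 → (Fin 4 → ℤ) → PK K k)
    (uA vA uB vB : (K k : ℕ) → (Fin (k + 2) → ℝ) → Fin 4 → Fin 4 → (Fin 4 → ℤ) → βK K k → ℝ)
    (CA CB : (K k : ℕ) → (Fin (k + 2) → ℝ) → Fin 4 → Fin 4 → (Fin 4 → ℤ) → Matrix (βK K k) (βK K k) ℝ)
    {κ θ₅ sA sC sB cA cC cB V : ℝ} (hκ : 0 ≤ κ) (hθ : 0 ≤ θ₅) (hsA : 0 ≤ sA) (hsC : 0 ≤ sC) (hsB : 0 ≤ sB)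
    (hcA : 0 ≤ cA) (hcC : 0 ≤ cC) (hcB : 0 ≤ cB)
    (hE : ∀ (k : ℕ) (w : Fin (k + 2) → ℝ), w ∈ Box γ (k + 1) → ∀ (μ ν : Fin 4) (x : Fin 4 → ℤ), ∀ᶠ K in atTop,
      polWindow F K (k + 1) (ℰ k (Fin.tail w) K) ρ bV μ ν x = uA K k w μ ν x ⬝ᵥ (CA K k w μ ν x *ᵥ vA K k w μ ν x) ∧
      polWindow F (K + s) (k + 1 + 1) (ℰ (k + 1) w (K + s)) ρ bV μ ν x = uB K k w μ ν x ⬝ᵥ (CB K k w μ ν x *ᵥ vB K k w μ ν x))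
    (hu : ∀ (K k : ℕ) (w : Fin (k + 2) → ℝ) (μ ν : Fin 4) (x : Fin 4 → ℤ) (i : βK K k),
      |uA K k w μ ν x i| ≤ sA * Real.exp (-(κ * ρd K k (p K k μ ν x) (q K k i))))
    (hCA : ∀ (K k : ℕ) (w : Fin (k + 2) → ℝ) (μ ν : Fin 4) (x : Fin 4 → ℤ) (i i' : βK K k),
      |CA K k w μ ν x i i'| ≤ sC * Real.exp (-(κ * ρd K k (q K k i) (q K k i'))))
    (hCB : ∀ (K k : ℕ) (w : Fin (k + 2) → ℝ) (μ ν : Fin 4) (x : Fin 4 → ℤ) (i i' : βK K k),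
      |CB K k w μ ν x i i'| ≤ sC * Real.exp (-(κ * ρd K k (q K k i) (q K k i'))))
    (hv : ∀ (K k : ℕ) (w : Fin (k + 2) → ℝ) (μ ν : Fin 4) (x : Fin 4 → ℤ) (i' : βK K k),
      |vB K k w μ ν x i'| ≤ sB * Real.exp (-(κ * ρd K k (q K k i') (r K k μ ν x))))
    (hdu : ∀ (K k : ℕ) (w : Fin (k + 2) → ℝ) (μ ν : Fin 4) (x : Fin 4 → ℤ) (i : βK K k),
      |uB K k w μ ν x i - uA K k w μ ν x i| ≤ cA * θ₅ ^ (k + 1) * Real.exp (-(κ * ρd K k (p K k μ ν x) (q K k i))))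
    (hdC : ∀ (K k : ℕ) (w : Fin (k + 2) → ℝ) (μ ν : Fin 4) (x : Fin 4 → ℤ) (i i' : βK K k),
      |CB K k w μ ν x i i' - CA K k w μ ν x i i'| ≤ cC * θ₅ ^ (k + 1) * Real.exp (-(κ * ρd K k (q K k i) (q K k i'))))
    (hdv : ∀ (K k : ℕ) (w : Fin (k + 2) → ℝ) (μ ν : Fin 4) (x : Fin 4 → ℤ) (i' : βK K k),
      |vB K k w μ ν x i' - vA K k w μ ν x i'| ≤ cB * θ₅ ^ (k + 1) * Real.exp (-(κ * ρd K k (q K k i') (r K k μ ν x))))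
    (hV : ∀ (K k : ℕ) (t : PK K k), ∑ i, Real.exp (-(κ / 2 * ρd K k t (q K k i))) ≤ V)
    (hd : ∀ (K k : ℕ) (μ ν : Fin 4) (x : Fin 4 → ℤ), l1 x ≤ ρd K k (p K k μ ν x) (r K k μ ν x)) :
    KernelStepRate F ℰ ρ bV γ (κ / 2) θ₅ ((cA * sC * sB + sA * cC * sB + sA * sC * cB) * V ^ 2) :=
  kernelStepRate_of_windowed F ρ bV s hex
    (windowedStepRate_of_threeFactorRates F ℰ ρ bV s ρd hρ0 hρtri q p r uA vA uB vB CA CB hκ hθ hsA hsC hsB hcA hcC hcB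
      hE hu hCA hCB hv hdu hdC hdv hV hd)


/-- ★ **RUN A's SIZES AT FINITE VOLUME GIVE W1-19b's WINDOWED (5.10) DECAY** (uniform constant): if for every box history `v ∈ ]0, γ]^{k+1}` and entry `(μ, ν, x)`, eventually in
`K`, `polWindow F K (k+1) (ℰ k v K) … x = u_A ⬝ (E_A v_A)` with sizes `sA, sC, sB`, decay `κ` through positions at pseudo-distance `≥ |x|₁` and lattice sums `≤ V` (uniform in `K`),
then `WindowedDecay F ℰ ρ bV (Window γ) μ ν (κ∕2)` with the constant `sA·sC·sB·V²` for every `g` (read at `v := (g_0, …, g_k) ∈ ]0, γ]^{k+1}`). [cite: Balaban1987RG1, (5.10) p.293 and (1.20) p.264; King1986, (4.41) p.675] -/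
theorem windowedDecay_of_threeFactorSizes
    (ρd : (K k : ℕ) → PK K k → PK K k → ℝ) (hρ0 : ∀ K k p q, 0 ≤ ρd K k p q) (hρtri : ∀ K k p q r, ρd K k p r ≤ ρd K k p q + ρd K k q r)
    (q : (K k : ℕ) → βK K k → PK K k) (p r : (K k : ℕ) → Fin 4 → Fin 4 → (Fin 4 → ℤ) → PK K k)
    (uA vA : (K k : ℕ) → (Fin (k + 1) → ℝ) → Fin 4 → Fin 4 → (Fin 4 → ℤ) → βK K k → ℝ)
    (CA : (K k : ℕ) → (Fin (k + 1) → ℝ) → Fin 4 → Fin 4 → (Fin 4 → ℤ) → Matrix (βK K k) (βK K k) ℝ)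
    {γ κ sA sC sB V : ℝ} (hκ : 0 ≤ κ) (hsA : 0 ≤ sA) (hsC : 0 ≤ sC) (hsB : 0 ≤ sB)
    (hA : ∀ (k : ℕ) (v : Fin (k + 1) → ℝ), v ∈ Box γ k → ∀ (μ ν : Fin 4) (x : Fin 4 → ℤ), ∀ᶠ K in atTop,
      polWindow F K (k + 1) (ℰ k v K) ρ bV μ ν x = uA K k v μ ν x ⬝ᵥ (CA K k v μ ν x *ᵥ vA K k v μ ν x))
    (hu : ∀ (K k : ℕ) (v : Fin (k + 1) → ℝ) (μ ν : Fin 4) (x : Fin 4 → ℤ) (i : βK K k),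
      |uA K k v μ ν x i| ≤ sA * Real.exp (-(κ * ρd K k (p K k μ ν x) (q K k i))))
    (hCA : ∀ (K k : ℕ) (v : Fin (k + 1) → ℝ) (μ ν : Fin 4) (x : Fin 4 → ℤ) (i i' : βK K k),
      |CA K k v μ ν x i i'| ≤ sC * Real.exp (-(κ * ρd K k (q K k i) (q K k i'))))
    (hvA : ∀ (K k : ℕ) (v : Fin (k + 1) → ℝ) (μ ν : Fin 4) (x : Fin 4 → ℤ) (i' : βK K k),
      |vA K k v μ ν x i'| ≤ sB * Real.exp (-(κ * ρd K k (q K k i') (r K k μ ν x))))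
    (hV : ∀ (K k : ℕ) (t : PK K k), ∑ i, Real.exp (-(κ / 2 * ρd K k t (q K k i))) ≤ V)
    (hd : ∀ (K k : ℕ) (μ ν : Fin 4) (x : Fin 4 → ℤ), l1 x ≤ ρd K k (p K k μ ν x) (r K k μ ν x)) (μ ν : Fin 4) :
    WindowedDecay F ℰ ρ bV (Window γ) μ ν (κ / 2) := by
  intro g hg
  refine ⟨sA * sC * sB * V ^ 2, fun k x => ?_⟩
  have hv : histPrefix g k ∈ Box γ k := mem_box.mpr fun i => hg i
  refine (hA k (histPrefix g k) hv μ ν x).mono fun K hK => ?_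
  rw [hK]
  refine (bilin_decay_bound (ρd K k) (hρ0 K k) (hρtri K k) (q K k) (p K k μ ν x) (r K k μ ν x) (uA K k _ μ ν x) (vA K k _ μ ν x)
    (CA K k _ μ ν x) hκ hsA hsC hsB (hu K k _ μ ν x) (hCA K k _ μ ν x) (hvA K k _ μ ν x) (hV K k)).trans ?_
  have hK0 : 0 ≤ sA * sC * sB * V ^ 2 := by positivity
  rw [neg_mul]
  exact mul_le_mul_of_nonneg_left
    (Real.exp_le_exp.mpr (neg_le_neg (mul_le_mul_of_nonneg_left (hd K k μ ν x) (by positivity)))) hK0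

variable {ℰ}

/-- **MONOTONICITY OF THE WINDOWED TWO-RUN STEP RATE** in `(κ, θ, C')`: weaker decay `κ' ≤ κ`, larger ratio `θ ≤ θ'` (`θ ≥ 0`), larger constant `C' ≤ C''` (`C'' ≥ 0`) — how a letter
block DOMINATING the mechanism's letters inherits the row. [cite: Balaban1987RG1, Thm 1 p.259 (bookkeeping)] -/
theorem windowedStepRate_mono {γ κ κ' θ θ' C' C'' : ℝ} {s : ℕ} (h : WindowedStepRate F ℰ ρ bV γ s κ θ C') (hκ : κ' ≤ κ) (hθ0 : 0 ≤ θ)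
    (hθ : θ ≤ θ') (hC : C' ≤ C'') (hC0 : 0 ≤ C'') : WindowedStepRate F ℰ ρ bV γ s κ' θ' C'' := by
  intro k w hw μ ν x
  refine (h k w hw μ ν x).mono fun K hK => hK.trans ?_
  have h1 : C' * θ ^ k ≤ C'' * θ' ^ k :=
    (mul_le_mul_of_nonneg_right hC (pow_nonneg hθ0 _)).trans (mul_le_mul_of_nonneg_left (pow_le_pow_left₀ hθ0 hθ _) hC0)
  have h2 : Real.exp (-κ * l1 x) ≤ Real.exp (-κ' * l1 x) := Real.exp_le_exp.mpr (by nlinarith [l1_nonneg x])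
  exact mul_le_mul h1 h2 (Real.exp_pos _).le (mul_nonneg hC0 (pow_nonneg (hθ0.trans hθ) _))

end FiniteVolume

/-! ## §6 At the record, Stage 13: the windowed rows `hS` (N18) and `hW` ((D4)) of the v5 bill from the mechanism on the record's windowed kernels -/

section Record

open scoped Matrix.Norms.L2Operator

variable (F : T4Family) (N : ℕ) [NeZero N]
variable {βK : ℕ → ℕ → Type*} [∀ K k, Fintype (βK K k)] {PK : ℕ → ℕ → Type*}

/-- ★★ **THE N18 ROW OF THE v5 BILL FROM KING's MECHANISM ON THE RECORD's WINDOWED KERNELS**: with run A's `Π^{(K)}_{k+1,μν}(tail w; x)` and run B's `Π^{(K+s)}_{k+2,μν}(w; x)` of the MERGED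
TERM FAMILY OF RECORD (record β-chart) three-factor read-outs eventually in `K`, sizes ∕ one-line rates ∕ decay ∕ lattice sums uniform in `K`, on the record's boxes `]0, θ.γ]^{k+2}` ⟹
`WindowedStepRateOfRecord₁₃ F N θ s (κ∕2) θ₅ (((cA·sC·sB + sA·cC·sB + sA·sC·cB)·V²)·θ₅)` — after `windowedStepRateOfRecord₁₃_mono` at a dominating block, the row `hS` of
`K3V5Defs.keyedRatesHolderD4_rrOfRecord_of_pins_of_letters`. [cite: King1986, Prop. 3.9 (3.73) p.665 and (4.42)–(4.43) p.675; Balaban1987RG1, Thm 1 p.259, (1.6) p.261 and (1.20)–(1.21) p.264] -/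
theorem windowedStepRateOfRecord₁₃_of_threeFactorRates (θ : Stage13Params F N) (s : ℕ)
    (ρd : (K k : ℕ) → PK K k → PK K k → ℝ) (hρ0 : ∀ K k p q, 0 ≤ ρd K k p q) (hρtri : ∀ K k p q r, ρd K k p r ≤ ρd K k p q + ρd K k q r)
    (q : (K k : ℕ) → βK K k → PK K k) (p r : (K k : ℕ) → Fin 4 → Fin 4 → (Fin 4 → ℤ) → PK K k)
    (uA vA uB vB : (K k : ℕ) → (Fin (k + 2) → ℝ) → Fin 4 → Fin 4 → (Fin 4 → ℤ) → βK K k → ℝ)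
    (CA CB : (K k : ℕ) → (Fin (k + 2) → ℝ) → Fin 4 → Fin 4 → (Fin 4 → ℤ) → Matrix (βK K k) (βK K k) ℝ)
    {κ θ₅ sA sC sB cA cC cB V : ℝ} (hκ : 0 ≤ κ) (hθ : 0 ≤ θ₅) (hsA : 0 ≤ sA) (hsC : 0 ≤ sC) (hsB : 0 ≤ sB)
    (hcA : 0 ≤ cA) (hcC : 0 ≤ cC) (hcB : 0 ≤ cB)
    (hE : (letI := θ.instVβ₁; letI := θ.instVβ₂; letI := θ.instιβ
      ∀ (k : ℕ) (w : Fin (k + 2) → ℝ), w ∈ Box θ.γ (k + 1) → ∀ (μ ν : Fin 4) (x : Fin 4 → ℤ), ∀ᶠ K in atTop,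
        polWindow F K (k + 1) (mergedTermFamilyMatT F N (TβOfRecord₁₃ F N) (chiβOfRecord₁₃ F N θ) θ.εbg k (Fin.tail w) K) θ.ρ8 θ.bV μ ν x =
            uA K k w μ ν x ⬝ᵥ (CA K k w μ ν x *ᵥ vA K k w μ ν x) ∧
          polWindow F (K + s) (k + 1 + 1) (mergedTermFamilyMatT F N (TβOfRecord₁₃ F N) (chiβOfRecord₁₃ F N θ) θ.εbg (k + 1) w (K + s)) θ.ρ8 θ.bV μ ν x =
            uB K k w μ ν x ⬝ᵥ (CB K k w μ ν x *ᵥ vB K k w μ ν x)))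
    (hu : ∀ (K k : ℕ) (w : Fin (k + 2) → ℝ) (μ ν : Fin 4) (x : Fin 4 → ℤ) (i : βK K k),
      |uA K k w μ ν x i| ≤ sA * Real.exp (-(κ * ρd K k (p K k μ ν x) (q K k i))))
    (hCA : ∀ (K k : ℕ) (w : Fin (k + 2) → ℝ) (μ ν : Fin 4) (x : Fin 4 → ℤ) (i i' : βK K k),
      |CA K k w μ ν x i i'| ≤ sC * Real.exp (-(κ * ρd K k (q K k i) (q K k i'))))
    (hCB : ∀ (K k : ℕ) (w : Fin (k + 2) → ℝ) (μ ν : Fin 4) (x : Fin 4 → ℤ) (i i' : βK K k),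
      |CB K k w μ ν x i i'| ≤ sC * Real.exp (-(κ * ρd K k (q K k i) (q K k i'))))
    (hv : ∀ (K k : ℕ) (w : Fin (k + 2) → ℝ) (μ ν : Fin 4) (x : Fin 4 → ℤ) (i' : βK K k),
      |vB K k w μ ν x i'| ≤ sB * Real.exp (-(κ * ρd K k (q K k i') (r K k μ ν x))))
    (hdu : ∀ (K k : ℕ) (w : Fin (k + 2) → ℝ) (μ ν : Fin 4) (x : Fin 4 → ℤ) (i : βK K k),
      |uB K k w μ ν x i - uA K k w μ ν x i| ≤ cA * θ₅ ^ (k + 1) * Real.exp (-(κ * ρd K k (p K k μ ν x) (q K k i))))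
    (hdC : ∀ (K k : ℕ) (w : Fin (k + 2) → ℝ) (μ ν : Fin 4) (x : Fin 4 → ℤ) (i i' : βK K k),
      |CB K k w μ ν x i i' - CA K k w μ ν x i i'| ≤ cC * θ₅ ^ (k + 1) * Real.exp (-(κ * ρd K k (q K k i) (q K k i'))))
    (hdv : ∀ (K k : ℕ) (w : Fin (k + 2) → ℝ) (μ ν : Fin 4) (x : Fin 4 → ℤ) (i' : βK K k),
      |vB K k w μ ν x i' - vA K k w μ ν x i'| ≤ cB * θ₅ ^ (k + 1) * Real.exp (-(κ * ρd K k (q K k i') (r K k μ ν x))))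
    (hV : ∀ (K k : ℕ) (t : PK K k), ∑ i, Real.exp (-(κ / 2 * ρd K k t (q K k i))) ≤ V)
    (hd : ∀ (K k : ℕ) (μ ν : Fin 4) (x : Fin 4 → ℤ), l1 x ≤ ρd K k (p K k μ ν x) (r K k μ ν x)) :
    WindowedStepRateOfRecord₁₃ F N θ s (κ / 2) θ₅ (((cA * sC * sB + sA * cC * sB + sA * sC * cB) * V ^ 2) * θ₅) := by
  letI := θ.instVβ₁; letI := θ.instVβ₂; letI := θ.instιβ
  exact windowedStepRate_of_threeFactorRates F _ θ.ρ8 θ.bV s ρd hρ0 hρtri q p r uA vA uB vB CA CB hκ hθ hsA hsC hsB hcA hcC hcB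
    hE hu hCA hCB hv hdu hdC hdv hV hd

/-- ★ **… HENCE THE N18 LETTER OF RECORD, GIVEN (1.21)'s EXISTENCE ON THE RECORD's BOXES**: the finite-volume mechanism on the record's windowed kernels and W1-19b's
`PolLimitsExistBoxOfRecord₁₃ F N θ` (itself available from `GeometricIncrementsOfRecord₁₃ F N θ r`, `r < 1`, by dag-n18-w2's `polLimitsExistBoxOfRecord₁₃_of_geometricIncrements`, p606911 —
the finite-volume door) give `KernelStepRateOfRecord₁₃ F N θ (κ∕2) θ₅ ((cA·sC·sB + sA·cC·sB + sA·sC·cB)·V²)` by dag-n18-w1's `kernelStepRateOfRecord₁₃_of_windowed`; under the v5 pin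
the N18 conjunct follows as in FILE 2 (`n18At_rateCarriers_of_kernels_pin_of_kernelStepRateOfRecord₁₃` after `kernelStepRateOfRecord₁₃_mono`).
[cite: King1986, Prop. 3.9 (3.73) p.665 and (4.42)–(4.43) p.675; Balaban1987RG1, Thm 1 p.259 and (1.20)–(1.21) p.264] -/
theorem kernelStepRateOfRecord₁₃_of_threeFactorRates_finiteVolume (θ : Stage13Params F N) (s : ℕ) (hex : PolLimitsExistBoxOfRecord₁₃ F N θ)
    (ρd : (K k : ℕ) → PK K k → PK K k → ℝ) (hρ0 : ∀ K k p q, 0 ≤ ρd K k p q) (hρtri : ∀ K k p q r, ρd K k p r ≤ ρd K k p q + ρd K k q r)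
    (q : (K k : ℕ) → βK K k → PK K k) (p r : (K k : ℕ) → Fin 4 → Fin 4 → (Fin 4 → ℤ) → PK K k)
    (uA vA uB vB : (K k : ℕ) → (Fin (k + 2) → ℝ) → Fin 4 → Fin 4 → (Fin 4 → ℤ) → βK K k → ℝ)
    (CA CB : (K k : ℕ) → (Fin (k + 2) → ℝ) → Fin 4 → Fin 4 → (Fin 4 → ℤ) → Matrix (βK K k) (βK K k) ℝ)
    {κ θ₅ sA sC sB cA cC cB V : ℝ} (hκ : 0 ≤ κ) (hθ : 0 ≤ θ₅) (hsA : 0 ≤ sA) (hsC : 0 ≤ sC) (hsB : 0 ≤ sB)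
    (hcA : 0 ≤ cA) (hcC : 0 ≤ cC) (hcB : 0 ≤ cB)
    (hE : (letI := θ.instVβ₁; letI := θ.instVβ₂; letI := θ.instιβ
      ∀ (k : ℕ) (w : Fin (k + 2) → ℝ), w ∈ Box θ.γ (k + 1) → ∀ (μ ν : Fin 4) (x : Fin 4 → ℤ), ∀ᶠ K in atTop,
        polWindow F K (k + 1) (mergedTermFamilyMatT F N (TβOfRecord₁₃ F N) (chiβOfRecord₁₃ F N θ) θ.εbg k (Fin.tail w) K) θ.ρ8 θ.bV μ ν x =
            uA K k w μ ν x ⬝ᵥ (CA K k w μ ν x *ᵥ vA K k w μ ν x) ∧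
          polWindow F (K + s) (k + 1 + 1) (mergedTermFamilyMatT F N (TβOfRecord₁₃ F N) (chiβOfRecord₁₃ F N θ) θ.εbg (k + 1) w (K + s)) θ.ρ8 θ.bV μ ν x =
            uB K k w μ ν x ⬝ᵥ (CB K k w μ ν x *ᵥ vB K k w μ ν x)))
    (hu : ∀ (K k : ℕ) (w : Fin (k + 2) → ℝ) (μ ν : Fin 4) (x : Fin 4 → ℤ) (i : βK K k),
      |uA K k w μ ν x i| ≤ sA * Real.exp (-(κ * ρd K k (p K k μ ν x) (q K k i))))
    (hCA : ∀ (K k : ℕ) (w : Fin (k + 2) → ℝ) (μ ν : Fin 4) (x : Fin 4 → ℤ) (i i' : βK K k),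
      |CA K k w μ ν x i i'| ≤ sC * Real.exp (-(κ * ρd K k (q K k i) (q K k i'))))
    (hCB : ∀ (K k : ℕ) (w : Fin (k + 2) → ℝ) (μ ν : Fin 4) (x : Fin 4 → ℤ) (i i' : βK K k),
      |CB K k w μ ν x i i'| ≤ sC * Real.exp (-(κ * ρd K k (q K k i) (q K k i'))))
    (hv : ∀ (K k : ℕ) (w : Fin (k + 2) → ℝ) (μ ν : Fin 4) (x : Fin 4 → ℤ) (i' : βK K k),
      |vB K k w μ ν x i'| ≤ sB * Real.exp (-(κ * ρd K k (q K k i') (r K k μ ν x))))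
    (hdu : ∀ (K k : ℕ) (w : Fin (k + 2) → ℝ) (μ ν : Fin 4) (x : Fin 4 → ℤ) (i : βK K k),
      |uB K k w μ ν x i - uA K k w μ ν x i| ≤ cA * θ₅ ^ (k + 1) * Real.exp (-(κ * ρd K k (p K k μ ν x) (q K k i))))
    (hdC : ∀ (K k : ℕ) (w : Fin (k + 2) → ℝ) (μ ν : Fin 4) (x : Fin 4 → ℤ) (i i' : βK K k),
      |CB K k w μ ν x i i' - CA K k w μ ν x i i'| ≤ cC * θ₅ ^ (k + 1) * Real.exp (-(κ * ρd K k (q K k i) (q K k i'))))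
    (hdv : ∀ (K k : ℕ) (w : Fin (k + 2) → ℝ) (μ ν : Fin 4) (x : Fin 4 → ℤ) (i' : βK K k),
      |vB K k w μ ν x i' - vA K k w μ ν x i'| ≤ cB * θ₅ ^ (k + 1) * Real.exp (-(κ * ρd K k (q K k i') (r K k μ ν x))))
    (hV : ∀ (K k : ℕ) (t : PK K k), ∑ i, Real.exp (-(κ / 2 * ρd K k t (q K k i))) ≤ V)
    (hd : ∀ (K k : ℕ) (μ ν : Fin 4) (x : Fin 4 → ℤ), l1 x ≤ ρd K k (p K k μ ν x) (r K k μ ν x)) :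
    KernelStepRateOfRecord₁₃ F N θ (κ / 2) θ₅ ((cA * sC * sB + sA * cC * sB + sA * sC * cB) * V ^ 2) :=
  kernelStepRateOfRecord₁₃_of_windowed F N θ s hex
    (windowedStepRateOfRecord₁₃_of_threeFactorRates F N θ s ρd hρ0 hρtri q p r uA vA uB vB CA CB hκ hθ hsA hsC hsB hcA hcC hcB
      hE hu hCA hCB hv hdu hdC hdv hV hd)

/-- ★★ **THE (D4) ROW OF THE v5 BILL FROM RUN A's SIZES ON THE RECORD's WINDOWED KERNELS**: three-factor read-outs of `Π^{(K)}_{k+1,μν}(v; x)` of the merged term of record at the box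
histories `v ∈ ]0, θ.γ]^{k+1}`, eventually in `K`, sizes ∕ decay ∕ lattice sums uniform in `K` ⟹ `WindowedDecayOfRecord₁₃ F N θ μ ν (κ∕2)` — at `(μ, ν) = (0, 1)` and after
`windowedDecayOfRecord₁₃_anti` to `ℓ.κ ≤ κ∕2`, the row `hW` of `K3V5Defs.keyedRatesHolderD4_rrOfRecord_of_pins_of_letters`. [cite: Balaban1987RG1, (5.10) p.293, (1.6) p.261 and (1.20) p.264; King1986, (4.41) p.675] -/
theorem windowedDecayOfRecord₁₃_of_threeFactorSizes (θ : Stage13Params F N)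
    (ρd : (K k : ℕ) → PK K k → PK K k → ℝ) (hρ0 : ∀ K k p q, 0 ≤ ρd K k p q) (hρtri : ∀ K k p q r, ρd K k p r ≤ ρd K k p q + ρd K k q r)
    (q : (K k : ℕ) → βK K k → PK K k) (p r : (K k : ℕ) → Fin 4 → Fin 4 → (Fin 4 → ℤ) → PK K k)
    (uA vA : (K k : ℕ) → (Fin (k + 1) → ℝ) → Fin 4 → Fin 4 → (Fin 4 → ℤ) → βK K k → ℝ)
    (CA : (K k : ℕ) → (Fin (k + 1) → ℝ) → Fin 4 → Fin 4 → (Fin 4 → ℤ) → Matrix (βK K k) (βK K k) ℝ)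
    {κ sA sC sB V : ℝ} (hκ : 0 ≤ κ) (hsA : 0 ≤ sA) (hsC : 0 ≤ sC) (hsB : 0 ≤ sB)
    (hA : (letI := θ.instVβ₁; letI := θ.instVβ₂; letI := θ.instιβ
      ∀ (k : ℕ) (v : Fin (k + 1) → ℝ), v ∈ Box θ.γ k → ∀ (μ ν : Fin 4) (x : Fin 4 → ℤ), ∀ᶠ K in atTop,
        polWindow F K (k + 1) (mergedTermFamilyMatT F N (TβOfRecord₁₃ F N) (chiβOfRecord₁₃ F N θ) θ.εbg k v K) θ.ρ8 θ.bV μ ν x =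
          uA K k v μ ν x ⬝ᵥ (CA K k v μ ν x *ᵥ vA K k v μ ν x)))
    (hu : ∀ (K k : ℕ) (v : Fin (k + 1) → ℝ) (μ ν : Fin 4) (x : Fin 4 → ℤ) (i : βK K k),
      |uA K k v μ ν x i| ≤ sA * Real.exp (-(κ * ρd K k (p K k μ ν x) (q K k i))))
    (hCA : ∀ (K k : ℕ) (v : Fin (k + 1) → ℝ) (μ ν : Fin 4) (x : Fin 4 → ℤ) (i i' : βK K k),
      |CA K k v μ ν x i i'| ≤ sC * Real.exp (-(κ * ρd K k (q K k i) (q K k i'))))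
    (hvA : ∀ (K k : ℕ) (v : Fin (k + 1) → ℝ) (μ ν : Fin 4) (x : Fin 4 → ℤ) (i' : βK K k),
      |vA K k v μ ν x i'| ≤ sB * Real.exp (-(κ * ρd K k (q K k i') (r K k μ ν x))))
    (hV : ∀ (K k : ℕ) (t : PK K k), ∑ i, Real.exp (-(κ / 2 * ρd K k t (q K k i))) ≤ V)
    (hd : ∀ (K k : ℕ) (μ ν : Fin 4) (x : Fin 4 → ℤ), l1 x ≤ ρd K k (p K k μ ν x) (r K k μ ν x)) (μ ν : Fin 4) :
    WindowedDecayOfRecord₁₃ F N θ μ ν (κ / 2) := by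
  letI := θ.instVβ₁; letI := θ.instVβ₂; letI := θ.instιβ
  exact windowedDecay_of_threeFactorSizes F _ θ.ρ8 θ.bV ρd hρ0 hρtri q p r uA vA CA hκ hsA hsC hsB hA hu hCA hvA hV hd μ ν

/-- Monotonicity of the windowed step-rate row of record in `(κ, θ₅, C')` — to the block's letters `((ℓ F θ).κ, .θ₅, .C₅·.θ₅)` for `hS`. [cite: Balaban1987RG1, Thm 1 p.259 (bookkeeping)] -/
theorem windowedStepRateOfRecord₁₃_mono (θ : Stage13Params F N) {s : ℕ} {κ κ' θ₅ θ₅' C' C'' : ℝ} (h : WindowedStepRateOfRecord₁₃ F N θ s κ θ₅ C')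
    (hκ : κ' ≤ κ) (hθ0 : 0 ≤ θ₅) (hθ : θ₅ ≤ θ₅') (hC : C' ≤ C'') (hC0 : 0 ≤ C'') : WindowedStepRateOfRecord₁₃ F N θ s κ' θ₅' C'' := by
  letI := θ.instVβ₁; letI := θ.instVβ₂; letI := θ.instιβ
  exact windowedStepRate_mono F θ.ρ8 θ.bV h hκ hθ0 hθ hC hC0

/-- The windowed decay row of record is antitone in the rate — to the block's `(ℓ F θ).κ` for `hW` (dag-n22-w2's `YMDAG.N22.WindowSoftTwoPoint.windowedDecay_of_le` at the record's
window, BY NAME). [cite: Balaban1987RG1, (5.10) p.293 (bookkeeping)] -/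
theorem windowedDecayOfRecord₁₃_anti (θ : Stage13Params F N) {μ ν : Fin 4} {κ κ' : ℝ} (h : WindowedDecayOfRecord₁₃ F N θ μ ν κ) (hκ : κ' ≤ κ) :
    WindowedDecayOfRecord₁₃ F N θ μ ν κ' := by
  letI := θ.instVβ₁; letI := θ.instVβ₂; letI := θ.instιβ
  exact windowedDecay_of_le F _ θ.ρ8 θ.bV h hκ

end Record

end YMDAG.N18.KernelStepRateKingMechanism

end
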